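import Summits.QuantumFields.BalabanUV.Beta.D1BFx.RWeightedLegPack
import Summits.QuantumFields.BalabanUV.Beta.D1BFx.GluonLegProfile
import Summits.QuantumFields.BalabanUV.Beta.BorderedHessianKernelAction

/-!
# `BalabanUV.Beta.D1BFx.RestLegContourSum` — road «BF-x» for binder row D1, slot (K), DICT-CHAIN-SPEC §2 (II) row RK-SAND, «SAND-ENV» FILE 1∕2:
# **THE `𝒬`-LEG OF THE SANDWICH** — `(Qp ∘ Gp Ga)(n•y₀; x′)` IS the UNNORMALISED straight-contour sum of the fine leg's column over the n⁵ legs of the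
# block `y₀` (exact, unconditional), and against the printed profile of `Ga` it is `O(n³)` with scale-`n` decay: ONE `(KQ, δ)` with
# `|contourSum n (Ga-column at x′) m′ y₀| ≤ n³·KQ·e^{−(δ∕(2n))‖x′ − n•y₀‖∞}` for every `n ≥ 1`, modulo [B5, Prop. 1.2] ∧ [B5, (1.126)–(1.127)] BY NAME

HONEST DEPENDENCY (cell records, verbatim): «continuum YM on T⁴ ⇐ BetaPertH ∧ nine spine estimates (0/9 proved); BetaPertH ⇐ (D1) ∧ (D4) ∧
CAP+tail; G-an2-4 gates asym, D1 and NE2/3/4.»  HONEST FRAMING (cell contract, verbatim): «discharging `BetaPertH` makes Bałaban's UV stability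
UNCONDITIONAL — a real constructive-QFT result; it is NOT the continuum limit and NOT the Clay problem.»  THIS MODULE DISCHARGES NOTHING of the
wall: [folklore] lattice bookkeeping BY NAME — the `𝒬`-action lemma `BorderedHessian.comp_bhK_inr` (gan24∕an2 lineage), the fine-leg PROFILE
`GluonLegProfile.exists_abs_Ga_le_profile` (the two printed [B5] statements enter ONLY there, as the hypotheses `h12 ∧ h126`, never proved), leaf-04-g9's
HLS kit `LatticeHLSRadial.sum_exp_div_nrm_pow_le` (`p = 2`), ne9-leaf-06's `RWeightedLegPack` entries.  No definition, no `def … : Prop`, nothing cited,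
0 sorry.  NO (1.22) row; 0 root-level binders of row D1 discharged; (K) NOT closed; NOT D1, NOT `BetaPertH`, NOT continuum, NOT Clay.

ABSOLUTE RULE (cell charter, verbatim): «No internally-minted statement may enter as a cited fact. Every hypothesis is either kernel-proved in
this package or a verbatim quotation of a PUBLISHED theorem with page reference. The manuscript(s) under audit are NOT citable for their own
disputed steps — they are the thing under adjudication; programme-internal (2001/route/tribunal) claims are never citable.»

WHY (`HOME/b2b-balaban-beta-d1-p2/DICT-CHAIN-SPEC.md` v1.2 §2 row RK-SAND; OWNER W-d1p2-g15-7 (2) «RK-SAND after leaf-01's SAND-ENV»).  The sandwich leg of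
«NLEG-HESS-SPLIT» is `sandP = HRp ∘ (Qp ∘ Gp)`; FILE 2 (`RestLegSandwich`) bounds its ff block by (the `ℋ_R` column, n⁻⁵) × (THIS file's `𝒬`-leg, n³)
summed over the coarse columns.  The count n³ = (n steps) × (n² = the HLS mass of `e^{−(δ∕n)‖·‖∞}∕nrm²` over a box of side `n`).

CONTENT.
* §1 [folklore, UNCONDITIONAL, any leg `Ga`] `Qp_inr_eq_bhK`, **`comp_Qp_inr_eq`** (`comp (Qp n) K x z (inr m′) b = comp (bhK n) K x z (inr m′) b`),
  **`comp_Qp_Gp_inr_inl`** (`= [proj n x = 0]·contourSum n (fun l y ↦ Ga y z l κ′) m′ (quo n x)`), `comp_Qp_Gp_coarse` (the n⁵-leg sum, definitional).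
* §2 [folklore] `sum_box_profile_le` (one straight contour's box against a scale-`n` profile: `≤ n²·(1 + 864∕δ + 3456∕δ²)`, HLS `p = 2` on the
  injective image of the box), `supNorm_leg_le` (legs within `2n` of the block corner), `exp_supNorm_shift_le`; [mod `h12 ∧ h126`]
  **`exists_contourSum_Ga_le`** (`KQ = kG·e^{δ}·(1 + 1728∕δ + 13824∕δ²)` from the profile's `(kG, δ)`).
Unit `b2b-balaban-beta-d1-formalise-leaf-01` (gen 20), D1 formalisation swarm leaf prover 01, road «BF-x»; INTENT 3 «SAND-ENV» (journal), FILE 1∕2.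
-/

noncomputable section

open Finset
open scoped BigOperators
open Literature.Probability.LatticeModels (Torus.proj)
open Literature.MathematicalPhysics.QuantumFieldTheory.LatticeForm (quo)
open Literature.MathematicalPhysics.QuantumFieldTheory.Balaban1983to89
open Literature.MathematicalPhysics.QuantumFieldTheory.Balaban1983to89.Beta
open B12Sec2to5 (l1 l1_nonneg)
open AffineAveraging (Form1 box toSite unitVec unitVec_apply contourSum)
open ExpKernelCalculus (Site MKer Decays comp)
open DyadicShell (Pt)
open PoissonInterior (nrm nrm_pos one_le_nrm nrm_neg supNorm supNorm_neg supNorm_add_le)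
open OneStepResolventKernel (Fib eq_zsmul_quo_of_proj quo_zsmul proj_zsmul)
open VectorTailsLoc (fam kfam)
open Summit.QuantumFields.BalabanUV.Beta.BorderedHessian (bhK bhK_inr_inr comp_bhK_inr fcol)
open Summit.QuantumFields.BalabanUV.Beta.D1BFx.RWeightedLegPack (Gp Qp Gp_inl_inl Gp_inr_inl Qp_inr_inl Qp_inr_inr)
open Summit.QuantumFields.BalabanUV.Beta.D1BFx.GluonLeg (Ga)
open Summit.QuantumFields.BalabanUV.Beta.D1BFx.GluonLegProfile (exists_abs_Ga_le_profile)
open Summit.QuantumFields.BalabanUV.Beta.D1BFx.LatticeHLSRadial (sum_exp_div_nrm_pow_le)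
open Summit.QuantumFields.BalabanUV.Beta.D1BFx.FrozenLegTails (nOf MOf hn1)

namespace Summit.QuantumFields.BalabanUV.Beta.D1BFx.RestLegContourSum

/-! ## §1 The multiplier rows of `Qp` are `bhK`'s: `(Qp ∘ Gp Ga)(n•y₀; x′)` is the unnormalised straight-contour sum of `Ga`'s column -/

section QAction

variable (n : ℕ) [NeZero n] {Ga : MKer 4 (Fin 4)}

omit [NeZero n] in
/-- [folklore] The multiplier rows of the `𝒬`-pack are those of the bordered Hessian kernel: `Qp n x y (inr m′) f = bhK n x y (inr m′) f`. -/
theorem Qp_inr_eq_bhK (x y : Fin 4 → ℤ) (m' : Fin 4) (f : Fib 3) : Qp n x y (Sum.inr m') f = bhK (d := 3) n x y (Sum.inr m') f := by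
  rcases f with l | l
  · exact Qp_inr_inl n x y m' l
  · rw [Qp_inr_inr, bhK_inr_inr]

omit [NeZero n] in
/-- [folklore] Hence the multiplier rows of `Qp ∘ K` are those of `bhK ∘ K`, for any kernel `K`. -/
theorem comp_Qp_inr_eq (K : MKer 4 (Fib 3)) (x z : Fin 4 → ℤ) (m' : Fin 4) (b : Fib 3) :
    comp (Qp n) K x z (Sum.inr m') b = comp (bhK (d := 3) n) K x z (Sum.inr m') b := by
  unfold ExpKernelCalculus.comp
  exact tsum_congr fun y => Finset.sum_congr rfl fun f _ => by rw [Qp_inr_eq_bhK]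

/-- [folklore] **`(𝒬 Ga)` AS A CONTOUR SUM**: `comp (Qp n) (Gp Ga) x z (inr m′) (inl κ′) = [proj n x = 0]·contourSum n (fun l y ↦ Ga y z l κ′) m′ (quo n x)` —
`BorderedHessian.comp_bhK_inr` at `X := Gp Ga` (`fcol (Gp Ga) z (inl κ′) l y = Ga y z l κ′` by `rfl`): the UNNORMALISED straight-contour sum
`Σ_{b ∈ box 4 n} Σ_{s < n} Ga (n•quo x + b + s•e_{m′}) z m′ κ′` over the n⁵ legs. UNCONDITIONAL, any `Ga`. -/
theorem comp_Qp_Gp_inr_inl (x z : Fin 4 → ℤ) (m' κ' : Fin 4) :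
    comp (Qp n) (Gp Ga) x z (Sum.inr m') (Sum.inl κ')
      = if Torus.proj n x = 0 then contourSum n (fun l y => Ga y z l κ') m' (quo n x) else 0 := by
  rw [comp_Qp_inr_eq, comp_bhK_inr]
  rfl

/-- [folklore] … at a coarse row `x = n•y₀`: `= contourSum n (fun l y ↦ Ga y z l κ′) m′ y₀ = Σ_{b ∈ box} Σ_{s < n} Ga (n•y₀ + toSite b + s•e_{m′}) z m′ κ′`. -/
theorem comp_Qp_Gp_coarse (y₀ z : Fin 4 → ℤ) (m' κ' : Fin 4) :
    comp (Qp n) (Gp Ga) ((n : ℤ) • y₀) z (Sum.inr m') (Sum.inl κ')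
      = ∑ b ∈ box 4 n, ∑ s ∈ Finset.range n, Ga ((n : ℤ) • y₀ + toSite b + (s : ℤ) • unitVec m') z m' κ' := by
  rw [comp_Qp_Gp_inr_inl, if_pos (proj_zsmul (N := n) y₀), quo_zsmul]
  rfl

end QAction

/-! ## §2 The contour sum of the fine leg's column against its profile: `n·n² = n³` (mod `h12 ∧ h126`) -/

section ProfileAux

/-- [folklore] **ONE STRAIGHT CONTOUR'S BOX AGAINST A SCALE-`n` PROFILE**: for `n ≥ 1`, `0 < δ`, a coarse point `y₀`, a step `s`, a direction `m′` and a fine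
point `x′`, `Σ_{b ∈ box 4 n} e^{−(δ∕n)‖x′ − (n•y₀ + b + s•e)‖∞}∕nrm(x′ − (n•y₀ + b + s•e))² ≤ n²·(1 + 864∕δ + 3456∕δ²)` — leaf-04-g9's HLS kit
`sum_exp_div_nrm_pow_le` at `p = 2` on the (injective) image of the box, the `n`-powers collected as in `GluonLegProfileD1`. -/
theorem sum_box_profile_le {δ : ℝ} (hδ : 0 < δ) (n : ℕ) [NeZero n] (y₀ x' : Fin 4 → ℤ) (s : ℕ) (m' : Fin 4) :
    ∑ b ∈ box 4 n, Real.exp (-(δ / n) * (supNorm (d := 4) (x' - ((n : ℤ) • y₀ + toSite b + (s : ℤ) • unitVec m')) : ℝ))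
        / nrm (d := 4) (x' - ((n : ℤ) • y₀ + toSite b + (s : ℤ) • unitVec m')) ^ 2
      ≤ (n : ℝ) ^ 2 * (1 + 864 / δ + 3456 / δ ^ 2) := by
  have hn1 : 1 ≤ n := NeZero.one_le
  have hn : (1 : ℝ) ≤ n := by exact_mod_cast hn1
  have hnpos : (0 : ℝ) < n := by positivity
  -- the legs of one straight contour's box are an injective image of the box
  set φ : (Fin 4 → ℕ) → (Fin 4 → ℤ) := fun b => (n : ℤ) • y₀ + toSite b + (s : ℤ) • unitVec m' with hφ
  have hinj : Set.InjOn φ (box 4 n : Set (Fin 4 → ℕ)) := by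
    intro b _ b' _ h
    have h' : toSite b = toSite b' := by
      have := congrArg (fun p => p - (n : ℤ) • y₀ - (s : ℤ) • unitVec m') h
      simpa [hφ] using this
    funext i
    have hi := congr_fun h' i
    simp only [toSite] at hi
    exact_mod_cast hi
  have e : ∑ b ∈ box 4 n, Real.exp (-(δ / n) * (supNorm (d := 4) (x' - φ b) : ℝ)) / nrm (d := 4) (x' - φ b) ^ 2
      = ∑ p ∈ (box 4 n).image φ, Real.exp (-(δ / n) * (supNorm (d := 4) (p - x') : ℝ)) / nrm (d := 4) (p - x') ^ 2 := by
    rw [Finset.sum_image hinj]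
    refine Finset.sum_congr rfl fun b _ => ?_
    rw [← neg_sub (φ b) x', supNorm_neg, nrm_neg]
  rw [e]
  have hkit := sum_exp_div_nrm_pow_le (d := 4) (by norm_num) (ε := δ / n) (by positivity) (p := 2) (by norm_num) ((box 4 n).image φ) x'
  refine hkit.trans ?_
  have e2 : (1 : ℝ) + 2 * (4 : ℕ) * 3 ^ (4 - 1) * (((4 - 1 - 2 : ℕ).factorial : ℝ) * (2 / (δ / n)) ^ (4 - 1 - 2) * (1 + 2 / (δ / n)))
      = 1 + 432 / δ * n + 864 / δ ^ 2 * n ^ 2 := by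
    rw [show (4 : ℕ) - 1 - 2 = 1 by norm_num, Nat.factorial_one, pow_one, Nat.cast_one, one_mul]
    field_simp
    ring
  rw [e2]
  have h1 : (1 : ℝ) ≤ (n : ℝ) ^ 2 := by nlinarith
  have hnn : (n : ℝ) ≤ (n : ℝ) ^ 2 := by nlinarith
  have hδ' : 0 ≤ 432 / δ := by positivity
  have h2a : 432 / δ * (n : ℝ) ≤ 432 / δ * (n : ℝ) ^ 2 := mul_le_mul_of_nonneg_left hnn hδ'
  have h2b : 0 ≤ 432 / δ * (n : ℝ) ^ 2 := mul_nonneg hδ' (sq_nonneg _)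
  have h3 : 0 ≤ 1 / δ ^ 2 * (n : ℝ) ^ 2 := by positivity
  have e3 : (n : ℝ) ^ 2 * (1 + 864 / δ + 3456 / δ ^ 2) - (1 + 432 / δ * n + 864 / δ ^ 2 * n ^ 2)
      = ((n : ℝ) ^ 2 - 1) + (432 / δ * (n : ℝ) ^ 2 - 432 / δ * n) + 432 / δ * (n : ℝ) ^ 2 + 2592 * (1 / δ ^ 2 * (n : ℝ) ^ 2) := by ring
  nlinarith [e3]

/-- [folklore] The legs of a block sit within sup-distance `2n` of its corner: `‖toSite b + s•e_{m′}‖∞ ≤ 2n` for `b ∈ box 4 n`, `s < n`. -/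
theorem supNorm_leg_le (n : ℕ) {b : Fin 4 → ℕ} (hb : b ∈ box 4 n) {s : ℕ} (hs : s ∈ Finset.range n) (m' : Fin 4) :
    (supNorm (d := 4) (toSite b + (s : ℤ) • unitVec m') : ℝ) ≤ 2 * n := by
  have hb' : ∀ i, b i < n := fun i => Finset.mem_range.1 (Fintype.mem_piFinset.1 hb i)
  have hs' : s < n := Finset.mem_range.1 hs
  have hcoord : ∀ i, ((toSite b + (s : ℤ) • unitVec m') i).natAbs ≤ 2 * n := by
    intro i
    simp only [Pi.add_apply, Pi.smul_apply, toSite, unitVec_apply, smul_eq_mul]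
    have := hb' i
    split_ifs <;> omega
  have h : supNorm (d := 4) (toSite b + (s : ℤ) • unitVec m') ≤ 2 * n := by
    unfold PoissonInterior.supNorm
    exact Finset.sup_le fun i _ => hcoord i
  exact_mod_cast h

/-- [folklore] Reverse triangle for the profile's exponent: `‖x′ − (c + v)‖∞ ≥ ‖x′ − c‖∞ − ‖v‖∞`, in the form
`e^{−ε‖x′ − (c+v)‖∞} ≤ e^{ε‖v‖∞}·e^{−ε‖x′ − c‖∞}` (`0 ≤ ε`). -/
theorem exp_supNorm_shift_le {ε : ℝ} (hε : 0 ≤ ε) (x' c v : Fin 4 → ℤ) :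
    Real.exp (-ε * (supNorm (d := 4) (x' - (c + v)) : ℝ))
      ≤ Real.exp (ε * (supNorm (d := 4) v : ℝ)) * Real.exp (-ε * (supNorm (d := 4) (x' - c) : ℝ)) := by
  rw [← Real.exp_add]
  apply Real.exp_le_exp.2
  have h : supNorm (d := 4) (x' - c) ≤ supNorm (d := 4) (x' - (c + v)) + supNorm (d := 4) v := by
    have e : x' - c = (x' - (c + v)) + v := by abel
    conv_lhs => rw [e]
    exact supNorm_add_le _ _
  have h' : (supNorm (d := 4) (x' - c) : ℝ) ≤ (supNorm (d := 4) (x' - (c + v)) : ℝ) + (supNorm (d := 4) v : ℝ) := by exact_mod_cast h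
  nlinarith

end ProfileAux

section Profile

variable {a : ℝ} (ha : 0 < a)
include ha

/-- [folklore] **THE CONTOUR SUM OF THE FINE LEG's COLUMN IS `O(n³)` WITH SCALE-`n` DECAY**, modulo [B5, Prop. 1.2] ∧ [B5, (1.126)–(1.127)] BY NAME
(`GluonLegProfile.exists_abs_Ga_le_profile`): ONE pair `(KQ, δ)` such that for EVERY block side `n ≥ 1`, fine point `x′`, coarse point `y₀` and colours
`m′ κ′`, `|contourSum n (fun l y ↦ Ga n a y x′ l κ′) m′ y₀| ≤ n³·KQ·e^{−(δ∕(2n))·‖x′ − n•y₀‖∞}` (`KQ = kG·e^{δ}·(1 + 1728∕δ + 13824∕δ²)`: the profile at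
half rate feeds `sum_box_profile_le`, the other half and the leg offsets `≤ 2n` give the block-scale decay; × the `n` steps). -/
theorem exists_contourSum_Ga_le (h12 : B5.Prop12Printed (fam nOf hn1 MOf a ha)) (h126 : B5.Kernel126_127Printed (kfam nOf MOf)) :
    ∃ KQ δ : ℝ, 0 < δ ∧ 0 ≤ KQ ∧ ∀ (n : ℕ) [NeZero n] (x' y₀ : Fin 4 → ℤ) (m' κ' : Fin 4),
      |contourSum n (fun l y => Ga n a y x' l κ') m' y₀|
        ≤ (n : ℝ) ^ 3 * KQ * Real.exp (-(δ / 2 / n) * (supNorm (d := 4) (x' - (n : ℤ) • y₀) : ℝ)) := by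
  obtain ⟨kG, δ, hδ, hkG, hprof⟩ := exists_abs_Ga_le_profile a ha h12 h126
  refine ⟨kG * Real.exp δ * (1 + 864 / (δ / 2) + 3456 / (δ / 2) ^ 2), δ, hδ, by positivity, fun n _ x' y₀ m' κ' => ?_⟩
  have hn1 : 1 ≤ n := NeZero.one_le
  have hn : (1 : ℝ) ≤ n := by exact_mod_cast hn1
  have hnpos : (0 : ℝ) < n := by positivity
  unfold AffineAveraging.contourSum
  -- termwise: profile, split the exponential in two halves, move one half to the block scale
  have hterm : ∀ b ∈ box 4 n, ∀ s ∈ Finset.range n,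
      |Ga n a ((n : ℤ) • y₀ + toSite b + (s : ℤ) • unitVec m') x' m' κ'|
        ≤ kG * Real.exp δ * Real.exp (-(δ / 2 / n) * (supNorm (d := 4) (x' - (n : ℤ) • y₀) : ℝ))
          * (Real.exp (-(δ / 2 / n) * (supNorm (d := 4) (x' - ((n : ℤ) • y₀ + toSite b + (s : ℤ) • unitVec m')) : ℝ))
            / nrm (d := 4) (x' - ((n : ℤ) • y₀ + toSite b + (s : ℤ) • unitVec m')) ^ 2) := by
    intro b hb s hs
    set p : Fin 4 → ℤ := (n : ℤ) • y₀ + toSite b + (s : ℤ) • unitVec m' with hp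
    refine (hprof n p x' m' κ').trans ?_
    have hsplit : Real.exp (-(δ / n) * (supNorm (d := 4) (x' - p) : ℝ))
        = Real.exp (-(δ / 2 / n) * (supNorm (d := 4) (x' - p) : ℝ)) * Real.exp (-(δ / 2 / n) * (supNorm (d := 4) (x' - p) : ℝ)) := by
      rw [← Real.exp_add]; congr 1; ring
    have hp' : p = (n : ℤ) • y₀ + (toSite b + (s : ℤ) • unitVec m') := by rw [hp, add_assoc]
    have hshift := exp_supNorm_shift_le (ε := δ / 2 / n) (by positivity) x' ((n : ℤ) • y₀) (toSite b + (s : ℤ) • unitVec m')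
    rw [← hp'] at hshift
    have hleg := supNorm_leg_le n hb hs m'
    have hoff : Real.exp (δ / 2 / n * (supNorm (d := 4) (toSite b + (s : ℤ) • unitVec m') : ℝ)) ≤ Real.exp δ := by
      apply Real.exp_le_exp.2
      have : δ / 2 / n * (supNorm (d := 4) (toSite b + (s : ℤ) • unitVec m') : ℝ) ≤ δ / 2 / n * (2 * n) :=
        mul_le_mul_of_nonneg_left hleg (by positivity)
      have e : δ / 2 / n * (2 * (n : ℝ)) = δ := by field_simp
      linarith
    have h1 : Real.exp (-(δ / 2 / n) * (supNorm (d := 4) (x' - p) : ℝ))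
        ≤ Real.exp δ * Real.exp (-(δ / 2 / n) * (supNorm (d := 4) (x' - (n : ℤ) • y₀) : ℝ)) :=
      hshift.trans (mul_le_mul_of_nonneg_right hoff (Real.exp_pos _).le)
    rw [hsplit]
    have hnrm : 0 < nrm (d := 4) (x' - p) ^ 2 := pow_pos (nrm_pos _) 2
    calc kG * (Real.exp (-(δ / 2 / n) * (supNorm (d := 4) (x' - p) : ℝ)) * Real.exp (-(δ / 2 / n) * (supNorm (d := 4) (x' - p) : ℝ)))
          / nrm (d := 4) (x' - p) ^ 2
        = kG * Real.exp (-(δ / 2 / n) * (supNorm (d := 4) (x' - p) : ℝ))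
            * (Real.exp (-(δ / 2 / n) * (supNorm (d := 4) (x' - p) : ℝ)) / nrm (d := 4) (x' - p) ^ 2) := by ring
      _ ≤ kG * (Real.exp δ * Real.exp (-(δ / 2 / n) * (supNorm (d := 4) (x' - (n : ℤ) • y₀) : ℝ)))
            * (Real.exp (-(δ / 2 / n) * (supNorm (d := 4) (x' - p) : ℝ)) / nrm (d := 4) (x' - p) ^ 2) := by
          gcongr
      _ = _ := by ring
  -- sum over the box (HLS at `p = 2`, rate `δ∕2∕n`) and over the `n` steps
  have hbox : ∀ s ∈ Finset.range n,
      ∑ b ∈ box 4 n, Real.exp (-(δ / 2 / n) * (supNorm (d := 4) (x' - ((n : ℤ) • y₀ + toSite b + (s : ℤ) • unitVec m')) : ℝ))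
          / nrm (d := 4) (x' - ((n : ℤ) • y₀ + toSite b + (s : ℤ) • unitVec m')) ^ 2
        ≤ (n : ℝ) ^ 2 * (1 + 864 / (δ / 2) + 3456 / (δ / 2) ^ 2) := by
    intro s _
    exact sum_box_profile_le (δ := δ / 2) (half_pos hδ) n y₀ x' s m'
  set E : ℝ := kG * Real.exp δ * Real.exp (-(δ / 2 / n) * (supNorm (d := 4) (x' - (n : ℤ) • y₀) : ℝ)) with hE
  have hE0 : 0 ≤ E := by positivity
  calc |∑ b ∈ box 4 n, ∑ s ∈ Finset.range n, Ga n a ((n : ℤ) • y₀ + toSite b + (s : ℤ) • unitVec m') x' m' κ'|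
      ≤ ∑ b ∈ box 4 n, ∑ s ∈ Finset.range n, |Ga n a ((n : ℤ) • y₀ + toSite b + (s : ℤ) • unitVec m') x' m' κ'| :=
        (Finset.abs_sum_le_sum_abs _ _).trans (Finset.sum_le_sum fun b _ => Finset.abs_sum_le_sum_abs _ _)
    _ ≤ ∑ b ∈ box 4 n, ∑ s ∈ Finset.range n, E *
          (Real.exp (-(δ / 2 / n) * (supNorm (d := 4) (x' - ((n : ℤ) • y₀ + toSite b + (s : ℤ) • unitVec m')) : ℝ))
            / nrm (d := 4) (x' - ((n : ℤ) • y₀ + toSite b + (s : ℤ) • unitVec m')) ^ 2) :=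
        Finset.sum_le_sum fun b hb => Finset.sum_le_sum fun s hs => hterm b hb s hs
    _ = E * ∑ s ∈ Finset.range n, ∑ b ∈ box 4 n,
          Real.exp (-(δ / 2 / n) * (supNorm (d := 4) (x' - ((n : ℤ) • y₀ + toSite b + (s : ℤ) • unitVec m')) : ℝ))
            / nrm (d := 4) (x' - ((n : ℤ) • y₀ + toSite b + (s : ℤ) • unitVec m')) ^ 2 := by
        rw [Finset.sum_comm, Finset.mul_sum]
        refine Finset.sum_congr rfl fun s _ => ?_
        rw [Finset.mul_sum]
    _ ≤ E * ∑ _s ∈ Finset.range n, (n : ℝ) ^ 2 * (1 + 864 / (δ / 2) + 3456 / (δ / 2) ^ 2) :=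
        mul_le_mul_of_nonneg_left (Finset.sum_le_sum hbox) hE0
    _ = (n : ℝ) ^ 3 * (kG * Real.exp δ * (1 + 864 / (δ / 2) + 3456 / (δ / 2) ^ 2))
          * Real.exp (-(δ / 2 / n) * (supNorm (d := 4) (x' - (n : ℤ) • y₀) : ℝ)) := by
        rw [Finset.sum_const, Finset.card_range, nsmul_eq_mul, hE]
        ring

end Profile

end Summit.QuantumFields.BalabanUV.Beta.D1BFx.RestLegContourSum

end
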